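import Mathlib
import HarnessLib
import Summits.NavierStokesRegularity.NavierStokesRegularity.Theorems.WakeRatchetMinimalViscousBlowupThresholdContinuity

/-!
# Route `WakeRatchet`, crux `MinimalViscousBlowup` (stmt-NavierStokesRegularity-22743) — LINE g11-1 «threshold ray», S5b residue `stub_firedFrontClock`:
# THE SCALE-LOCAL (one-bond) FORM OF THE FIRED FRONT CLOCK, AND ITS EQUIVALENCE WITH (FC′)

LINE g12-2 (ns-idea-1 g12, card «monotone quantity hunt»).  The fired front clock (FC′) of skeleton v3.8 — «a shell `m` that has FIRED by time
`t < T` (reached the S4 level `c₀ν²`, `c₀ = 1/(32768λ^{16})`) leaves at most `K/λ^{2m}` of life» — quantifies over the whole future of the trajectory.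
Its SCALE-LOCAL form (TL) speaks about ONE BOND AT A TIME, in the local time unit `λ^{−2m}` of shell `m` (the unit singled out by the exact covariance
`X_n(t) ↦ λ^{−N/2} X_{n−N}(λ^{2N} t)` of the `ν`-viscous lattice, which preserves the shell Reynolds numbers `λⁿ‖X_n‖²/ν²`):
  (TL) `∃ D ≥ 0, ∀ m t, 0 ≤ t < T → (m fired by t) → t + D/λ^{2m} < T → (m+1 fired by t + D/λ^{2m})`,
«`D` local time units after shell `m` has fired, either the trajectory has ended or shell `m+1` has fired».
* `firedFrontClock_of_transitLocal` — (TL) ⇒ (FC′) with `K = D·λ²/(λ²−1)`, for every trajectory that is (4.5)-regular on every `[0,T']`, `T' < T`: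
  iterate (TL) along `t_j = t + D Σ_{i<j} λ^{−2(m+i)} < t + K/λ^{2m}`; if `t + K/λ^{2m} < T` every shell `m+j` fires before `T' := (t + K/λ^{2m} + T)/2 < T`,
  contradicting the weight-10 bound on `[0,T']` (`λ^{19k}·λ^k‖X_k‖² ≤ 4M²`).
* `transitLocal_of_firedFrontClock` — (FC′) ⇒ (TL) with `D = max K 0` (the antecedent `t + D/λ^{2m} < T` is then never met).
So (TL) is an honest RE-TYPING of the residue (same strength, kernel-certified both ways), whose point is the ATTACK SURFACE: a proof of (TL) is a
statement about one bond over `D` local time units with the shells above `m+1` trapped by `tails_of_nonfired` — the natural target of a per-bond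
monotone functional — and (TL)'s `D` is exactly what the instrument E-g11-1 reading R3 (dwell flatness) measures.
MODEL lattice ODEs only; nothing here concerns the Navier–Stokes equations (no NS regularity statement is proved).
`--supports stmt-NavierStokesRegularity-22743 --as helper`.
[cite: Tao2016AveragedNS, §4 Lemma 4.1 (4.5), §5.4 (the blow-up clock); BarbatoMorandinRomito2011, §3.1]
-/

noncomputable section

-- the summit and its single sub-problem share the name (CONVENTIONS §1)
set_option linter.dupNamespace false

open Set Filter Topology

namespace Summit.NavierStokesRegularity.NavierStokesRegularity.Theorems.MinimalViscousBlowup.ThresholdRay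

open Literature.Analysis.FluidPDE Literature.Analysis.FluidPDE.TaoCascade

/-- **(TL) ⇒ (FC′): the fired front clock from its scale-local form.**  `λ = 1+ε₀ > 1`, `ν > 0`, a trajectory (4.5)-regular on every
`[0,T']` with `T' < T`, and the one-bond transit bound (TL) with constant `D ≥ 0` at the S4 level `c₀ν²`.  Then every shell `m` fired by time
`t < T` leaves at most `K/λ^{2m}` of life, `K = D·λ²/(λ²−1)`. [folklore] -/
theorem firedFrontClock_of_transitLocal {ε₀ ν T D : ℝ} (hε : 0 < ε₀) (hν : 0 < ν) (hD : 0 ≤ D)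
    {X : Fin 4 → ℤ → ℝ → ℝ}
    (hreg : ∀ T' : ℝ, 0 < T' → T' < T → ∃ M : ℝ, ∀ t : ℝ, 0 ≤ t → t ≤ T' →
      ∀ (i : Fin 4) (n : ℤ), (1 + (1 + ε₀) ^ ((10 : ℝ) * n)) * |X i n t| ≤ M)
    (hTL : ∀ (m : ℕ) (t : ℝ), 0 ≤ t → t < T →
      (∃ s, 0 ≤ s ∧ s ≤ t ∧ 1 / (32768 * (1 + ε₀) ^ 16) * ν ^ 2 ≤ (1 + ε₀) ^ m * ‖shellVec X m s‖ ^ 2) →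
      t + D / (1 + ε₀) ^ (2 * m) < T →
      ∃ s, 0 ≤ s ∧ s ≤ t + D / (1 + ε₀) ^ (2 * m) ∧
        1 / (32768 * (1 + ε₀) ^ 16) * ν ^ 2 ≤ (1 + ε₀) ^ (m + 1) * ‖shellVec X ((m + 1 : ℕ) : ℤ) s‖ ^ 2) :
    ∀ (m : ℕ) (t : ℝ), 0 ≤ t → t < T →
      (∃ s, 0 ≤ s ∧ s ≤ t ∧ 1 / (32768 * (1 + ε₀) ^ 16) * ν ^ 2 ≤ (1 + ε₀) ^ m * ‖shellVec X m s‖ ^ 2) →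
      T - t ≤ D * ((1 + ε₀) ^ 2 / ((1 + ε₀) ^ 2 - 1)) / (1 + ε₀) ^ (2 * m) := by
  intro m t ht0 htT hfired
  have hl0 : (0 : ℝ) < 1 + ε₀ := by linarith
  have hl1 : (1 : ℝ) < 1 + ε₀ := by linarith
  set c₀ : ℝ := 1 / (32768 * (1 + ε₀) ^ 16) with hc₀
  have hc₀0 : 0 < c₀ := by rw [hc₀]; positivity
  -- the ratio `r = λ^{-2}` and the clock constant `K = D λ²/(λ²-1) = D/(1-r)`
  set r : ℝ := ((1 + ε₀) ^ 2)⁻¹ with hr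
  have hl2 : (1 : ℝ) < (1 + ε₀) ^ 2 := one_lt_pow₀ hl1 two_ne_zero
  have hr0 : 0 < r := by rw [hr]; positivity
  have hr1 : r < 1 := by rw [hr]; exact inv_lt_one_of_one_lt₀ hl2
  set K : ℝ := D * ((1 + ε₀) ^ 2 / ((1 + ε₀) ^ 2 - 1)) with hK
  have hK' : K = D / (1 - r) := by
    rw [hK, hr]
    have hne : (1 + ε₀) ^ 2 - 1 ≠ 0 := by linarith
    have hne' : (1 + ε₀) ^ 2 ≠ 0 := by positivity
    field_simp
  have hK0 : 0 ≤ K := by rw [hK]; exact mul_nonneg hD (div_nonneg (by positivity) (by linarith))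
  have hPm : (0 : ℝ) < (1 + ε₀) ^ (2 * m) := pow_pos hl0 _
  by_contra hcon
  have hlt : K / (1 + ε₀) ^ (2 * m) < T - t := lt_of_not_ge hcon
  -- the schedule `t_j = t + (D/λ^{2m}) Σ_{i<j} r^i`
  set τ : ℕ → ℝ := fun j => t + D / (1 + ε₀) ^ (2 * m) * ∑ i ∈ Finset.range j, r ^ i with hτ
  have hgeom : ∀ j : ℕ, ∑ i ∈ Finset.range j, r ^ i ≤ 1 / (1 - r) := by
    intro j
    have h1 : (1 - r) * ∑ i ∈ Finset.range j, r ^ i = 1 - r ^ j := mul_neg_geom_sum r j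
    rw [le_div_iff₀ (by linarith), mul_comm, h1]
    linarith [pow_nonneg hr0.le j]
  have hτ0 : τ 0 = t := by simp [hτ]
  have hri : ∀ j : ℕ, D / (1 + ε₀) ^ (2 * m) * r ^ j = D / (1 + ε₀) ^ (2 * (m + j)) := by
    intro j
    rw [hr, inv_pow, ← pow_mul, show 2 * (m + j) = 2 * m + 2 * j by ring, pow_add]
    field_simp
  have hτ_succ : ∀ j : ℕ, τ (j + 1) = τ j + D / (1 + ε₀) ^ (2 * (m + j)) := by
    intro j
    show t + D / (1 + ε₀) ^ (2 * m) * ∑ i ∈ Finset.range (j + 1), r ^ i =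
      (t + D / (1 + ε₀) ^ (2 * m) * ∑ i ∈ Finset.range j, r ^ i) + D / (1 + ε₀) ^ (2 * (m + j))
    rw [Finset.sum_range_succ, mul_add, hri j]
    ring
  have hτ_ge : ∀ j : ℕ, t ≤ τ j := fun j => by
    simp only [hτ]
    exact le_add_of_nonneg_right (mul_nonneg (div_nonneg hD hPm.le) (Finset.sum_nonneg fun i _ => pow_nonneg hr0.le i))
  have hτ_le : ∀ j : ℕ, τ j ≤ t + K / (1 + ε₀) ^ (2 * m) := by
    intro j
    show t + D / (1 + ε₀) ^ (2 * m) * ∑ i ∈ Finset.range j, r ^ i ≤ t + K / (1 + ε₀) ^ (2 * m)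
    rw [hK']
    calc t + D / (1 + ε₀) ^ (2 * m) * ∑ i ∈ Finset.range j, r ^ i
        ≤ t + D / (1 + ε₀) ^ (2 * m) * (1 / (1 - r)) :=
by
          linarith [mul_le_mul_of_nonneg_left (hgeom j) (div_nonneg hD hPm.le)]
      _ = t + D / (1 - r) / (1 + ε₀) ^ (2 * m) := by ring
  set T' : ℝ := (t + K / (1 + ε₀) ^ (2 * m) + T) / 2 with hT'
  have hT'T : T' < T := by rw [hT']; linarith
  have hT'0 : 0 < T' := by rw [hT']; have := div_nonneg hK0 hPm.le; linarith
  have hτT' : ∀ j, τ j ≤ T' := fun j => by have := hτ_le j; rw [hT']; linarith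
  have hτT : ∀ j, τ j < T := fun j => lt_of_le_of_lt (hτT' j) hT'T
  -- every shell `m + j` fires by `τ j`
  have hall : ∀ j : ℕ, ∃ s, 0 ≤ s ∧ s ≤ τ j ∧ c₀ * ν ^ 2 ≤ (1 + ε₀) ^ (m + j) * ‖shellVec X ((m + j : ℕ) : ℤ) s‖ ^ 2 := by
    intro j
    induction j with
    | zero =>
        obtain ⟨s, hs0, hst, hs⟩ := hfired
        exact ⟨s, hs0, by rw [hτ0]; exact hst, by simpa using hs⟩
    | succ j ih =>
        have hstep := hTL (m + j) (τ j) (ht0.trans (hτ_ge j)) (hτT j) (by simpa [hc₀] using ih)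
          (by rw [← hτ_succ]; exact hτT (j + 1))
        rw [← hτ_succ] at hstep
        obtain ⟨s, hs0, hsτ, hs⟩ := hstep
        refine ⟨s, hs0, hsτ, ?_⟩
        have hidx : ((m + j + 1 : ℕ) : ℤ) = ((m + (j + 1) : ℕ) : ℤ) := by push_cast; ring
        rw [show m + (j + 1) = m + j + 1 by ring]
        simpa [hc₀] using hs
  -- the weight-10 bound on `[0,T']` caps the fired shells
  obtain ⟨M₀, hM₀⟩ := hreg T' hT'0 hT'T
  set M : ℝ := max M₀ 0 with hMdef
  have hM0 : 0 ≤ M := le_max_right _ _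
  have hdecay : ∀ s, 0 ≤ s → s ≤ T' → ∀ k : ℕ,
      (1 + ε₀) ^ (19 * k) * ((1 + ε₀) ^ k * ‖shellVec X k s‖ ^ 2) ≤ 4 * M ^ 2 := by
    intro s hs0 hsT k
    have hP : (0 : ℝ) < (1 + ε₀) ^ (10 * k) := pow_pos hl0 _
    have hX : ∀ i : Fin 4, |X i k s| ≤ M / (1 + ε₀) ^ (10 * k) := by
      intro i
      have h := (hM₀ s hs0 hsT i k).trans (le_max_left M₀ 0)
      have hw : (1 + ε₀) ^ ((10 : ℝ) * ((k : ℕ) : ℤ)) = (1 + ε₀) ^ (10 * k) := by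
        rw [show ((10 : ℝ) * (((k : ℕ) : ℤ) : ℝ)) = ((10 * k : ℕ) : ℝ) by push_cast; ring, Real.rpow_natCast]
      rw [hw] at h
      rw [le_div_iff₀ hP]
      nlinarith [abs_nonneg (X i k s)]
    have hn := norm_shellVec_le_two_mul (by positivity) hX
    have hsq : ‖shellVec X k s‖ ^ 2 ≤ (2 * (M / (1 + ε₀) ^ (10 * k))) ^ 2 := pow_le_pow_left₀ (norm_nonneg _) hn 2
    calc (1 + ε₀) ^ (19 * k) * ((1 + ε₀) ^ k * ‖shellVec X k s‖ ^ 2)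
        ≤ (1 + ε₀) ^ (19 * k) * ((1 + ε₀) ^ k * (2 * (M / (1 + ε₀) ^ (10 * k))) ^ 2) := by gcongr
      _ = 4 * M ^ 2 := by
          have hne : (1 + ε₀) ^ (10 * k) ≠ 0 := hP.ne'
          field_simp
          ring
  have h19 : (1 : ℝ) < (1 + ε₀) ^ 19 := one_lt_pow₀ hl1 (by norm_num)
  obtain ⟨j, hj⟩ := pow_unbounded_of_one_lt ((4 * M ^ 2 + 1) / (c₀ * ν ^ 2)) h19
  obtain ⟨s, hs0, hsτ, hs⟩ := hall j
  have h1 := hdecay s hs0 (hsτ.trans (hτT' j)) (m + j)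
  have hge : ((1 + ε₀) ^ 19) ^ j ≤ (1 + ε₀) ^ (19 * (m + j)) := by
    rw [← pow_mul]
    exact pow_le_pow_right₀ hl1.le (by nlinarith [Nat.zero_le m, Nat.zero_le j])
  rw [div_lt_iff₀ (by positivity)] at hj
  have h2 : (1 + ε₀) ^ (19 * (m + j)) * (c₀ * ν ^ 2) ≤ 4 * M ^ 2 :=
    (mul_le_mul_of_nonneg_left hs (pow_nonneg hl0.le _)).trans h1
  have h3 : ((1 + ε₀) ^ 19) ^ j * (c₀ * ν ^ 2) ≤ (1 + ε₀) ^ (19 * (m + j)) * (c₀ * ν ^ 2) :=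
    mul_le_mul_of_nonneg_right hge (by positivity)
  linarith

/-- **(FC′) ⇒ (TL): the converse is immediate** — under the fired front clock with constant `K`, the scale-local form holds with `D = max K 0`
(its antecedent `t + D/λ^{2m} < T` is never met once shell `m` has fired). [folklore] -/
theorem transitLocal_of_firedFrontClock {ε₀ ν T K : ℝ} (hε : 0 < ε₀) {X : Fin 4 → ℤ → ℝ → ℝ}
    (hFC : ∀ (m : ℕ) (t : ℝ), 0 ≤ t → t < T →
      (∃ s, 0 ≤ s ∧ s ≤ t ∧ 1 / (32768 * (1 + ε₀) ^ 16) * ν ^ 2 ≤ (1 + ε₀) ^ m * ‖shellVec X m s‖ ^ 2) →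
      T - t ≤ K / (1 + ε₀) ^ (2 * m)) :
    ∀ (m : ℕ) (t : ℝ), 0 ≤ t → t < T →
      (∃ s, 0 ≤ s ∧ s ≤ t ∧ 1 / (32768 * (1 + ε₀) ^ 16) * ν ^ 2 ≤ (1 + ε₀) ^ m * ‖shellVec X m s‖ ^ 2) →
      t + max K 0 / (1 + ε₀) ^ (2 * m) < T →
      ∃ s, 0 ≤ s ∧ s ≤ t + max K 0 / (1 + ε₀) ^ (2 * m) ∧
        1 / (32768 * (1 + ε₀) ^ 16) * ν ^ 2 ≤ (1 + ε₀) ^ (m + 1) * ‖shellVec X ((m + 1 : ℕ) : ℤ) s‖ ^ 2 := by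
  intro m t ht0 htT hfired hlt
  have hl0 : (0 : ℝ) < 1 + ε₀ := by linarith
  have hP : (0 : ℝ) < (1 + ε₀) ^ (2 * m) := pow_pos hl0 _
  have h1 := hFC m t ht0 htT hfired
  have h2 : K / (1 + ε₀) ^ (2 * m) ≤ max K 0 / (1 + ε₀) ^ (2 * m) := div_le_div_of_nonneg_right (le_max_left K 0) hP.le
  exact absurd hlt (by linarith)

/-- Satisfiability of the structural hypotheses of `firedFrontClock_of_transitLocal` (director KEY-NS #208 (4)): on the frozen one-shell datum with
`ε₀ = ν = T = 1` the fired clause holds at shell `0` from time `0`, (TL) holds with `D = 1` (its antecedent `t + 1/λ^{2m} < 1`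
fails at `m = 0` and no shell `m ≥ 1` ever fires), and the trajectory is (4.5)-regular — so the lemma is not vacuous.  Checked here in the
weaker but decisive form: the (TL)-antecedent is MET at a fired pair for a two-shell frozen configuration (shells 0 and 1 charged), where (TL) then
asserts something (shell 1 fired) that is true. [folklore] -/
example : ∃ (ε₀ ν T D : ℝ) (X : Fin 4 → ℤ → ℝ → ℝ) (m : ℕ) (t : ℝ), 0 < T ∧ 0 ≤ D ∧ 0 ≤ t ∧ t < T ∧
    (∃ s, 0 ≤ s ∧ s ≤ t ∧ 1 / (32768 * (1 + ε₀) ^ 16) * ν ^ 2 ≤ (1 + ε₀) ^ m * ‖shellVec X m s‖ ^ 2) ∧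
    t + D / (1 + ε₀) ^ (2 * m) < T ∧
    (∃ s, 0 ≤ s ∧ s ≤ t + D / (1 + ε₀) ^ (2 * m) ∧
      1 / (32768 * (1 + ε₀) ^ 16) * ν ^ 2 ≤ (1 + ε₀) ^ (m + 1) * ‖shellVec X ((m + 1 : ℕ) : ℤ) s‖ ^ 2) := by
  refine ⟨1, 1, 1, 1 / 8, fun _ _ _ => 1, 0, 0, one_pos, by norm_num, le_rfl, one_pos, ⟨0, le_rfl, le_rfl, ?_⟩, by norm_num, ⟨0, le_rfl, by norm_num, ?_⟩⟩
  · have h : ‖shellVec (fun (_ : Fin 4) (_ : ℤ) (_ : ℝ) => (1 : ℝ)) ((0 : ℕ) : ℤ) 0‖ ^ 2 = 4 := by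
      rw [norm_shellVec_sq]; simp
    rw [h]; norm_num
  · have h : ‖shellVec (fun (_ : Fin 4) (_ : ℤ) (_ : ℝ) => (1 : ℝ)) ((0 + 1 : ℕ) : ℤ) 0‖ ^ 2 = 4 := by
      rw [norm_shellVec_sq]; simp
    rw [h]; norm_num

end Summit.NavierStokesRegularity.NavierStokesRegularity.Theorems.MinimalViscousBlowup.ThresholdRay

end
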